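import Mathlib.Analysis.SpecialFunctions.Log.Deriv
import Mathlib.Analysis.Complex.ExponentialBounds
import Mathlib.Analysis.Normed.Ring.InfiniteSum
import Mathlib.Analysis.SpecificLimits.Basic
import HarnessLib

/-!
# The renewal–unfolding axiom class cannot beat `1/log`: a Kaluza witness (lane «pcv-sawmu», route R44 «LOG-CEILING»)

Topic `Literature/Probability/RandomPlanarGeometry` (a BARRIER for the lane's bridge-rate proofs; no SAW object is imported:
the statement is about the abstract axiom class those proofs use).

Sources. T. Kaluza, *Über die Koeffizienten reziproker Potenzreihen*, Math. Z. 28 (1928) 161–170, Satz 3: if `u_0 = 1`,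
`u_n > 0` and `(u_n)` is log-convex then the coefficients `f_n` of `F = 1 - 1/U` are non-negative (here for
`u_n = 1/(n+1)`, whose `f_n` are the Gregory coefficients `1/2, 1/12, 1/24, 19/720, …`). W. Feller, *An Introduction to
Probability Theory and its Applications* I (1968), Ch. XIII §3: the renewal equation `u_n = Σ_{k=1}^n f_k u_{n-k}` and its
generating-function form `U(s) = 1/(1 - F(s))`; recurrence `Σ f_n = 1` iff `Σ u_n = ∞`. The axioms themselves are the
SAW bridge facts of N. Madras, G. Slade, *The Self-Avoiding Walk* (1993): `b` super-multiplicative (1.2.17), `b_n ≤ μ^n ≤ c_n`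
(1.2.10)/(1.2.17), the Hammersley–Welsh inequality in generating-function form (Corollary 3.1.8 / (3.1.15)), the renewal
equation and Kesten's relation `Σ λ_k μ^{-k} = 1` (§4.2), and "irreducible bridges have infinite mean length"
(Duminil-Copin–Hammond 2013, Theorem 2.5).

## What is proved (lane «pcv-sawmu», a-idea-1 `Sketch_G9.lean` §R44; the structure `RenewalHWSystem`, `RenewalHWSystem.tail`
## and `LogCeilingWitness` are the planner's, VERBATIM)

* `LogCeiling.u n = 1/(n+1)`, `LogCeiling.f` = its renewal coefficients (a primitive-recursive table `ftab`), `renewal`,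
  **`f_nonneg`** (Kaluza's theorem for this sequence: strong induction on Kaluza's identity
  `f_{N+1} u_N = Σ_j f_{j+1} (u_{N+1} u_{N-1-j} - u_N u_{N-j})` with non-negative brackets by log-convexity), `f_le_u`;
* generating functions on `(0,1)`: `hasSum_u_mul_pow` (`U(x) = -log(1-x)/x`), **`tsum_f_mul_pow_eq`**
  (`F(x) = 1 - x/(-log(1-x))`, Cauchy product), `sum_f_le_one`, **`hasSum_f : Σ f_n = 1`** (Kesten's relation of the witness);
* **`tail_ge`**: `Σ_{k > T} f_k ≥ 1/(8 log T)` for `T ≥ 3` (from `Σ_{n≤T} f_n ≤ F(x) + T(1-x)` at `1 - x = 1/(16 T log T)`: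
  `-log(1-x) = log 16 + log T + log log T ≤ 4 log T`, `x ≥ 3/4`); **`not_summable_mul_f`**: `Σ k f_k = ∞`
  (else `x/(-log(1-x)) = 1 - F(x) ≤ m(1-x)`, false at `1 - x = e^{-4m-4}`); `hwGF_witness`: with `μ = 2`, `c_n = 2^n`,
  `Σ (2x)^n = 1/(1-2x) ≤ x⁻¹ exp(2 Σ_{n≥1} (2x)^n/(n+1))` since `Σ_{n≥1} y^n/(n+1) ≥ -(1/2) log(1-y)`;
* `LogCeiling.witness : RenewalHWSystem` (`μ = 2`, `b_n = 2^n/(n+1)`, `λ_n = 2^n f_n`, `c_n = 2^n`) and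
  **`logCeilingWitness : LogCeilingWitness`** (the planner's stub `stub_R44_1_logCeiling`).

Consequence for the lane (the planner's reading, not formalised here): every rate proved from these axioms alone — the
Kesten tail `ε_T ≤ 2/log(T/μ)` (R25a), the renewal-count rate, `λ_n/b_n ≤ K/log n` — is sharp up to constants within
the axiom class; improvements need geometric input (patterns, planarity). Printed status: renewal sequences with slowly
varying tails are classical (Kaluza 1928; Feller XIII); their use as a formal barrier for SAW bridge rates is the lane's.
Tree-twin search: stems `Kaluza`, `LogCeiling`, `RenewalHWSystem`, `Gregory` → none. No twin.
-/

noncomputable section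

open Finset Filter Topology
open scoped BigOperators

namespace Literature.Probability.RandomPlanarGeometry.SAW

namespace LogCeiling

/-! ### The Kaluza sequence `u_n = 1/(n+1)` and its renewal coefficients -/

/-- `u_n = 1/(n+1)`. [cite: Kaluza1928, Satz 3 (the sequence 1/(n+1) is log-convex)] -/
def u (n : ℕ) : ℝ := 1 / ((n : ℝ) + 1)

/-- `u_n > 0`. [cite: Kaluza1928, Satz 3] -/
theorem u_pos (n : ℕ) : 0 < u n := by unfold u; positivity

/-- `u_0 = 1`. [cite: Kaluza1928, Satz 3] -/
theorem u_zero : u 0 = 1 := by simp [u]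

/-- `u_n ≤ 1`. [cite: Kaluza1928, Satz 3] -/
theorem u_le_one (n : ℕ) : u n ≤ 1 := by
  unfold u; rw [div_le_one (by positivity)]; linarith [(Nat.cast_nonneg n : (0 : ℝ) ≤ n)]

/-- Log-convexity in ratio form: `u_{m+1} u_n ≤ u_{n+1} u_m` for `m ≤ n` (the ratios `u_{k+1}/u_k = (k+1)/(k+2)` do not
decrease). [cite: Kaluza1928, Satz 3 (hypothesis)] -/
theorem u_ratio_mono {m n : ℕ} (h : m ≤ n) : u (m + 1) * u n ≤ u (n + 1) * u m := by
  unfold u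
  have hm : (m : ℝ) ≤ n := by exact_mod_cast h
  rw [div_mul_div_comm, div_mul_div_comm, one_mul, div_le_div_iff₀ (by positivity) (by positivity)]
  push_cast
  nlinarith

/-- The table of renewal coefficients: `ftab n` agrees with `f` on `[0, n]` (primitive recursion carrying the
prefix). [cite: Feller1968, Ch. XIII §3 (the renewal equation u_n = Σ f_k u_{n-k})] -/
def ftab : ℕ → ℕ → ℝ
  | 0 => fun _ => 0
  | n + 1 => fun k => if k ≤ n then ftab n k
      else if k = n + 1 then u (n + 1) - ∑ j ∈ range n, ftab n (j + 1) * u (n - j) else 0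

/-- The renewal coefficients `f_n` of `u` (`f_0 = 0`, `u_n = Σ_{k=1}^n f_k u_{n-k}`, written with `k = j + 1`, `j < n`).
[cite: Feller1968, Ch. XIII §3 (the renewal equation)] -/
def f (k : ℕ) : ℝ := ftab k k

/-- Stability of the table. [cite: Feller1968, Ch. XIII §3] -/
theorem ftab_eq_f : ∀ n k, k ≤ n → ftab n k = f k := by
  intro n
  induction n with
  | zero => intro k hk; obtain rfl : k = 0 := Nat.le_zero.1 hk; rfl
  | succ n ih =>
    intro k hk
    rcases Nat.lt_or_ge k (n + 1) with hlt | hge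
    · have hkn : k ≤ n := Nat.lt_succ_iff.1 hlt
      show (if k ≤ n then ftab n k else _) = f k
      rw [if_pos hkn, ih k hkn]
    · obtain rfl : k = n + 1 := le_antisymm hk hge
      rfl

/-- `f_0 = 0`. [cite: Feller1968, Ch. XIII §3] -/
theorem f_zero : f 0 = 0 := rfl

/-- The recursion: `f_{n+1} = u_{n+1} - Σ_{j<n} f_{j+1} u_{n-j}`. [cite: Feller1968, Ch. XIII §3] -/
theorem f_succ (n : ℕ) : f (n + 1) = u (n + 1) - ∑ j ∈ range n, f (j + 1) * u (n - j) := by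
  have h1 : f (n + 1) = u (n + 1) - ∑ j ∈ range n, ftab n (j + 1) * u (n - j) := by
    show ftab (n + 1) (n + 1) = _
    show (if n + 1 ≤ n then ftab n (n + 1) else
      if n + 1 = n + 1 then u (n + 1) - ∑ j ∈ range n, ftab n (j + 1) * u (n - j) else 0) = _
    rw [if_neg (by omega), if_pos rfl]
  rw [h1]
  congr 1
  refine Finset.sum_congr rfl fun j hj => ?_
  rw [ftab_eq_f n (j + 1) (by have := Finset.mem_range.1 hj; omega)]

/-- **The renewal equation**: `u_n = Σ_{k=1}^{n} f_k u_{n-k}` for `n ≥ 1` (with `k = j+1`).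
[cite: Feller1968, Ch. XIII §3, eq. (3.1)] -/
theorem renewal {n : ℕ} (hn : 1 ≤ n) : u n = ∑ j ∈ range n, f (j + 1) * u (n - 1 - j) := by
  obtain ⟨m, rfl⟩ : ∃ m, n = m + 1 := ⟨n - 1, by omega⟩
  rw [Finset.sum_range_succ, show m + 1 - 1 - m = 0 by omega, u_zero, mul_one, f_succ]
  have : ∑ x ∈ range m, f (x + 1) * u (m + 1 - 1 - x) = ∑ x ∈ range m, f (x + 1) * u (m - x) :=
    Finset.sum_congr rfl fun x _ => by rw [show m + 1 - 1 - x = m - x by omega]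
  rw [this]
  ring

/-- The renewal equation as an antidiagonal identity: `Σ_{k ≤ n} f_k u_{n-k} = u_n` (`n ≥ 1`; the `k = 0` term
vanishes). [cite: Feller1968, Ch. XIII §3, eq. (3.1)] -/
theorem sum_range_succ_f_mul_u {n : ℕ} (hn : 1 ≤ n) : ∑ k ∈ range (n + 1), f k * u (n - k) = u n := by
  rw [Finset.sum_range_succ', f_zero, zero_mul, add_zero, renewal hn]
  exact Finset.sum_congr rfl fun j _ => by rw [show n - (j + 1) = n - 1 - j by omega]

/-- **Kaluza's theorem for `u_n = 1/(n+1)`**: the renewal coefficients are non-negative (log-convexity of `u`).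
[cite: Kaluza1928, Satz 3] -/
theorem f_nonneg : ∀ n, 0 ≤ f n := by
  -- strong induction; the step is Kaluza's identity
  -- `f_{N+1} u_N = Σ_{j<N} f_{j+1} (u_{N+1} u_{N-1-j} - u_N u_{N-j})` with non-negative brackets
  suffices h : ∀ N, ∀ n ≤ N, 0 ≤ f n from fun n => h n n le_rfl
  intro N
  induction N with
  | zero => intro n hn; obtain rfl : n = 0 := Nat.le_zero.1 hn; rw [f_zero]
  | succ N ih =>
    intro n hn
    rcases Nat.lt_or_ge n (N + 1) with hlt | hge
    · exact ih n (Nat.lt_succ_iff.1 hlt)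
    obtain rfl : n = N + 1 := le_antisymm hn hge
    rcases Nat.eq_zero_or_pos N with rfl | hN
    · rw [f_succ]; simp [u]
    -- Kaluza's identity, multiplied by `u_N > 0`
    have key : f (N + 1) * u N = ∑ j ∈ range N, f (j + 1) * (u (N + 1) * u (N - 1 - j) - u N * u (N - j)) := by
      rw [f_succ, sub_mul, Finset.sum_mul]
      have hren := renewal hN
      calc u (N + 1) * u N - ∑ j ∈ range N, f (j + 1) * u (N - j) * u N
          = u (N + 1) * ∑ j ∈ range N, f (j + 1) * u (N - 1 - j) - ∑ j ∈ range N, f (j + 1) * u (N - j) * u N := by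
            rw [← hren]
        _ = _ := by rw [Finset.mul_sum, ← Finset.sum_sub_distrib]; refine Finset.sum_congr rfl fun j _ => ?_; ring
    have hsum : 0 ≤ ∑ j ∈ range N, f (j + 1) * (u (N + 1) * u (N - 1 - j) - u N * u (N - j)) := by
      refine Finset.sum_nonneg fun j hj => mul_nonneg (ih (j + 1) (by have := Finset.mem_range.1 hj; omega)) ?_
      have hjN := Finset.mem_range.1 hj
      have h := u_ratio_mono (show N - 1 - j ≤ N by omega)
      rw [show N - 1 - j + 1 = N - j by omega] at h
      linarith
    rw [← key] at hsum
    exact (mul_nonneg_iff_of_pos_right (u_pos N)).1 hsum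

/-- `f_n ≤ u_n`. [cite: Kaluza1928, Satz 3] -/
theorem f_le_u (n : ℕ) : f n ≤ u n := by
  rcases Nat.eq_zero_or_pos n with rfl | hn
  · rw [f_zero]; exact (u_pos 0).le
  obtain ⟨m, rfl⟩ : ∃ m, n = m + 1 := ⟨n - 1, by omega⟩
  rw [f_succ]
  have : 0 ≤ ∑ j ∈ range m, f (j + 1) * u (m - j) :=
    Finset.sum_nonneg fun j _ => mul_nonneg (f_nonneg _) (u_pos _).le
  linarith

/-- `f_n ≤ 1`. [cite: Kaluza1928, Satz 3] -/
theorem f_le_one (n : ℕ) : f n ≤ 1 := (f_le_u n).trans (u_le_one n)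

/-! ### Generating functions on `(0, 1)` -/

/-- `Σ u_n x^n` is summable for `0 ≤ x < 1`. [cite: Feller1968, Ch. XIII §3 (generating functions U(s), F(s))] -/
theorem summable_u_mul_pow {x : ℝ} (h0 : 0 ≤ x) (h1 : x < 1) : Summable fun n => u n * x ^ n :=
  Summable.of_nonneg_of_le (fun n => mul_nonneg (u_pos n).le (pow_nonneg h0 n))
    (fun n => mul_le_of_le_one_left (pow_nonneg h0 n) (u_le_one n)) (summable_geometric_of_lt_one h0 h1)

/-- `Σ f_n x^n` is summable for `0 ≤ x < 1`. [cite: Feller1968, Ch. XIII §3] -/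
theorem summable_f_mul_pow {x : ℝ} (h0 : 0 ≤ x) (h1 : x < 1) : Summable fun n => f n * x ^ n :=
  Summable.of_nonneg_of_le (fun n => mul_nonneg (f_nonneg n) (pow_nonneg h0 n))
    (fun n => mul_le_of_le_one_left (pow_nonneg h0 n) (f_le_one n)) (summable_geometric_of_lt_one h0 h1)

/-- **`U(x) = -log(1-x)/x`**: `Σ u_n x^n = -log(1-x)/x` for `0 < x < 1`. [cite: Feller1968, Ch. XIII §3] -/
theorem hasSum_u_mul_pow {x : ℝ} (h0 : 0 < x) (h1 : x < 1) :
    HasSum (fun n => u n * x ^ n) (-Real.log (1 - x) / x) := by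
  have h := (Real.hasSum_pow_div_log_of_abs_lt_one (show |x| < 1 by rw [abs_of_pos h0]; exact h1)).mul_right x⁻¹
  rw [← div_eq_mul_inv] at h
  have hfun : (fun n => u n * x ^ n) = fun i : ℕ => x ^ (i + 1) / ((i : ℝ) + 1) * x⁻¹ := by
    funext n
    unfold u
    rw [pow_succ]
    field_simp
  rw [hfun]
  exact h

/-- `U(x) > 0`. [cite: Feller1968, Ch. XIII §3] -/
theorem U_pos {x : ℝ} (h0 : 0 < x) (h1 : x < 1) : 0 < -Real.log (1 - x) / x := by
  have : Real.log (1 - x) < 0 := Real.log_neg (by linarith) (by linarith)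
  exact div_pos (by linarith) h0

/-- **The generating-function form of the renewal equation**: `U(x) · F(x) = U(x) - 1`, i.e. `F(x) = 1 - 1/U(x)`,
for `0 < x < 1`. [cite: Feller1968, Ch. XIII §3, eq. (3.2) (U(s) = 1/(1 - F(s)))] -/
theorem tsum_f_mul_pow_eq {x : ℝ} (h0 : 0 < x) (h1 : x < 1) :
    ∑' n, f n * x ^ n = 1 - x / (-Real.log (1 - x)) := by
  set U := -Real.log (1 - x) / x with hU
  have hUpos : 0 < U := U_pos h0 h1
  have hsu := summable_u_mul_pow h0.le h1
  have hsf := summable_f_mul_pow h0.le h1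
  have hUsum : ∑' n, u n * x ^ n = U := (hasSum_u_mul_pow h0 h1).tsum_eq
  -- Cauchy product
  have hnu : Summable fun n => ‖u n * x ^ n‖ :=
    hsu.congr fun n => (Real.norm_of_nonneg (mul_nonneg (u_pos n).le (pow_nonneg h0.le n))).symm
  have hnf : Summable fun n => ‖f n * x ^ n‖ :=
    hsf.congr fun n => (Real.norm_of_nonneg (mul_nonneg (f_nonneg n) (pow_nonneg h0.le n))).symm
  have hprod := tsum_mul_tsum_eq_tsum_sum_antidiagonal_of_summable_norm hnf hnu
  -- the antidiagonal sums: `x^n u_n` for `n ≥ 1`, `0` for `n = 0`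
  have hanti : ∀ n, ∑ kl ∈ antidiagonal n, f kl.1 * x ^ kl.1 * (u kl.2 * x ^ kl.2) =
      u n * x ^ n - if n = 0 then 1 else 0 := by
    intro n
    rw [Finset.Nat.sum_antidiagonal_eq_sum_range_succ fun i j => f i * x ^ i * (u j * x ^ j)]
    have : ∀ k ∈ range (n + 1), f k * x ^ k * (u (n - k) * x ^ (n - k)) = f k * u (n - k) * x ^ n := by
      intro k hk
      have hk' : k ≤ n := Nat.lt_succ_iff.1 (Finset.mem_range.1 hk)
      rw [show x ^ n = x ^ k * x ^ (n - k) by rw [← pow_add, Nat.add_sub_cancel' hk']]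
      ring
    rw [Finset.sum_congr rfl this, ← Finset.sum_mul]
    rcases Nat.eq_zero_or_pos n with rfl | hn
    · simp [f_zero, u_zero]
    · rw [sum_range_succ_f_mul_u hn, if_neg (by omega), sub_zero]
  have hrhs : HasSum (fun n => u n * x ^ n - if n = 0 then (1 : ℝ) else 0) (U - 1) :=
    (hasSum_u_mul_pow h0 h1).sub (hasSum_ite_eq 0 1)
  have hFU : (∑' n, f n * x ^ n) * U = U - 1 := by
    rw [← hUsum, hprod]
    rw [hUsum]
    simp_rw [hanti]
    exact hrhs.tsum_eq
  -- solve for `F`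
  have hx : x / (-Real.log (1 - x)) = U⁻¹ := by rw [hU, inv_div]
  rw [hx]
  field_simp
  linarith

/-- Partial sums of the generating function are bounded by it. [cite: Feller1968, Ch. XIII §3] -/
theorem sum_f_mul_pow_le {x : ℝ} (h0 : 0 < x) (h1 : x < 1) (N : ℕ) :
    ∑ n ∈ range N, f n * x ^ n ≤ 1 - x / (-Real.log (1 - x)) := by
  rw [← tsum_f_mul_pow_eq h0 h1]
  exact sum_le_hasSum (range N) (fun n _ => mul_nonneg (f_nonneg n) (pow_nonneg h0.le n))
    (summable_f_mul_pow h0.le h1).hasSum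

/-- **The partial sums of `f` are at most `1`.** [cite: Feller1968, Ch. XIII §3 (F(1) ≤ 1)] -/
theorem sum_f_le_one (N : ℕ) : ∑ n ∈ range N, f n ≤ 1 := by
  by_contra hgt
  rw [not_le] at hgt
  set S := ∑ n ∈ range N, f n with hS
  have hS0 : 0 < S := lt_trans one_pos hgt
  have hN : 0 < N := by
    rcases Nat.eq_zero_or_pos N with h | h
    · exfalso; subst h; norm_num [hS] at hgt
    · exact h
  -- take `x` close to `1`: `1 - x = (S - 1)/(2 N S)`, so that `x^N S ≥ (1 - N(1-x)) S = (S+1)/2 > 1`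
  set ε := (S - 1) / (2 * N * S) with hε
  have hε0 : 0 < ε := by rw [hε]; exact div_pos (by linarith) (by positivity)
  have hε1 : ε < 1 := by
    rw [hε, div_lt_one (by positivity)]
    have : (1 : ℝ) ≤ N := by exact_mod_cast hN
    nlinarith
  set x := 1 - ε with hx
  have hx0 : 0 < x := by rw [hx]; linarith
  have hx1 : x < 1 := by rw [hx]; linarith
  have hbern : 1 - N * ε ≤ x ^ N := by
    have := one_add_mul_le_pow (show (-2 : ℝ) ≤ -ε by linarith) N
    have e : x = 1 + -ε := by rw [hx]; ring
    rw [e]; linarith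
  have hpow : ∀ n ∈ range N, f n * x ^ N ≤ f n * x ^ n := fun n hn =>
    mul_le_mul_of_nonneg_left (pow_le_pow_of_le_one hx0.le hx1.le (Finset.mem_range.1 hn).le) (f_nonneg n)
  have h1 : S * x ^ N ≤ ∑ n ∈ range N, f n * x ^ n := by
    rw [hS, Finset.sum_mul]; exact Finset.sum_le_sum hpow
  have h2 := sum_f_mul_pow_le hx0 hx1 N
  have h3 : 0 < x / (-Real.log (1 - x)) := div_pos hx0 (by
    have : Real.log (1 - x) < 0 := Real.log_neg (by linarith) (by linarith); linarith)
  have h4 : S * (1 - N * ε) ≤ S * x ^ N := mul_le_mul_of_nonneg_left hbern hS0.le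
  have h5 : S * (1 - N * ε) = (S + 1) / 2 := by
    rw [hε]; field_simp; ring
  linarith

/-- `f` is summable. [cite: Feller1968, Ch. XIII §3] -/
theorem summable_f : Summable f := summable_of_sum_range_le f_nonneg sum_f_le_one

/-- **Kesten's relation for the witness: `Σ f_n = 1`** (`u` is not summable, so the renewal sequence is recurrent).
[cite: Feller1968, Ch. XIII §3, Theorem 1 (recurrent iff Σ u_n = ∞)] -/
theorem hasSum_f : HasSum f 1 := by
  have hle : ∑' n, f n ≤ 1 := Real.tsum_le_of_sum_range_le f_nonneg sum_f_le_one
  have hge : 1 ≤ ∑' n, f n := by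
    -- `Σ f_n ≥ F(x) = 1 - x/(-log(1-x)) ≥ 1 - 1/(-log(1-x))`, and `-log(1-x) → ∞`
    refine le_of_forall_pos_lt_add fun ε hε => ?_
    -- choose `x = 1 - exp(-2/ε)`
    set x := 1 - Real.exp (-(2 / ε)) with hx
    have hex : Real.exp (-(2 / ε)) < 1 := Real.exp_lt_one_iff.2 (by simp [hε])
    have hx0 : 0 < x := by rw [hx]; linarith
    have hx1 : x < 1 := by rw [hx]; linarith [Real.exp_pos (-(2 / ε))]
    have hlog : -Real.log (1 - x) = 2 / ε := by
      rw [hx, sub_sub_cancel, Real.log_exp]; ring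
    have hF : 1 - x / (-Real.log (1 - x)) ≤ ∑' n, f n := by
      rw [← tsum_f_mul_pow_eq hx0 hx1]
      exact (summable_f_mul_pow hx0.le hx1).tsum_le_tsum
        (fun n => mul_le_of_le_one_right (f_nonneg n) (pow_le_one₀ hx0.le hx1.le)) summable_f
    rw [hlog] at hF
    have h2 : ε * (2 / ε) = 2 := by field_simp
    have : x / (2 / ε) < ε := by rw [div_lt_iff₀ (by positivity), h2]; linarith
    linarith
  rw [show (1 : ℝ) = ∑' n, f n from le_antisymm hge hle]
  exact summable_f.hasSum

/-! ### The tail `Σ_{k > T} f_k ≥ 1/(8 log T)` and the infinite mean -/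

/-- Bernoulli: `1 - x^n ≤ n (1 - x)` for `0 ≤ x ≤ 1`. [cite: Feller1968, Ch. XIII §3] -/
private theorem one_sub_pow_le {x : ℝ} (h0 : 0 ≤ x) (n : ℕ) : 1 - x ^ n ≤ n * (1 - x) := by
  have := one_add_mul_le_pow (show (-2 : ℝ) ≤ x - 1 by linarith) n
  rw [add_sub_cancel] at this
  linarith

/-- **Tail lower bound through the generating function**: for `0 < x < 1` and every `T`,
`Σ_{n ≤ T} f_n ≤ 1 - x/(-log(1-x)) + T (1 - x)`. [cite: Feller1968, Ch. XIII §3 (generating functions); Kaluza1928, Satz 3] -/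
theorem sum_f_le_gf (T : ℕ) {x : ℝ} (h0 : 0 < x) (h1 : x < 1) :
    ∑ n ∈ range (T + 1), f n ≤ 1 - x / (-Real.log (1 - x)) + T * (1 - x) := by
  have hsplit : ∑ n ∈ range (T + 1), f n =
      ∑ n ∈ range (T + 1), f n * x ^ n + ∑ n ∈ range (T + 1), f n * (1 - x ^ n) := by
    rw [← Finset.sum_add_distrib]; exact Finset.sum_congr rfl fun n _ => by ring
  have h2 : ∑ n ∈ range (T + 1), f n * (1 - x ^ n) ≤ ∑ n ∈ range (T + 1), f n * (T * (1 - x)) := by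
    refine Finset.sum_le_sum fun n hn => mul_le_mul_of_nonneg_left ?_ (f_nonneg n)
    have hnT : (n : ℝ) ≤ T := by exact_mod_cast Nat.lt_succ_iff.1 (Finset.mem_range.1 hn)
    exact (one_sub_pow_le h0.le n).trans (mul_le_mul_of_nonneg_right hnT (by linarith))
  rw [← Finset.sum_mul] at h2
  have h3 : (∑ n ∈ range (T + 1), f n) * (T * (1 - x)) ≤ 1 * (T * (1 - x)) :=
    mul_le_mul_of_nonneg_right (sum_f_le_one (T + 1)) (by have : (0 : ℝ) ≤ T := T.cast_nonneg; nlinarith)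
  have h1' := sum_f_mul_pow_le h0 h1 (T + 1)
  linarith

/-- `Σ_{k > T} f_k = 1 - Σ_{k ≤ T} f_k`. [cite: Feller1968, Ch. XIII §3] -/
theorem tsum_f_tail (T : ℕ) : ∑' k, f (k + T + 1) = 1 - ∑ n ∈ range (T + 1), f n := by
  have h := summable_f.sum_add_tsum_nat_add (T + 1)
  rw [hasSum_f.tsum_eq] at h
  have : ∑' k, f (k + T + 1) = ∑' k, f (k + (T + 1)) := by simp only [add_assoc]
  linarith

/-- Numerical constants: `log 3 ≥ 1` (so `log T ≥ 1` for `T ≥ 3`) and `log 16 ≤ 2.78`. [cite: Feller1968, Ch. XIII §3] -/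
private theorem one_le_log_of_three_le {T : ℕ} (hT : 3 ≤ T) : 1 ≤ Real.log T := by
  have h3 : (3 : ℝ) ≤ T := by exact_mod_cast hT
  have he : Real.exp 1 ≤ 3 := by have := Real.exp_one_lt_d9; linarith
  calc (1 : ℝ) = Real.log (Real.exp 1) := (Real.log_exp 1).symm
    _ ≤ Real.log T := Real.log_le_log (Real.exp_pos 1) (he.trans h3)

/-- `log 16 ≤ 2.78`. [folklore] -/
private theorem log_sixteen_le : Real.log 16 ≤ 2.78 := by
  rw [show (16 : ℝ) = 2 ^ 4 by norm_num, Real.log_pow]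
  have := Real.log_two_lt_d9
  push_cast
  nlinarith

/-- **The tail of the Gregory renewal coefficients**: `Σ_{k > T} f_k ≥ 1/(8 log T)` for `T ≥ 3`
(take `1 - x = 1/(16 T log T)` in `sum_f_le_gf`: `-log(1-x) = log 16 + log T + log log T ≤ 4 log T`, `x ≥ 3/4`).
[cite: Kaluza1928, Satz 3; Feller1968, Ch. XIII §3 (quantitative form, this file)] -/
theorem tail_ge (T : ℕ) (hT : 3 ≤ T) : 1 / (8 * Real.log T) ≤ ∑' k, f (k + T + 1) := by
  set ℓ := Real.log T with hℓ
  have hℓ1 : 1 ≤ ℓ := one_le_log_of_three_le hT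
  have hT3 : (3 : ℝ) ≤ T := by exact_mod_cast hT
  set ε : ℝ := 1 / (16 * T * ℓ) with hε
  have hε0 : 0 < ε := by rw [hε]; positivity
  have hεle : ε ≤ 1 / 48 := by
    rw [hε, div_le_div_iff₀ (by positivity) (by norm_num)]
    nlinarith
  set x : ℝ := 1 - ε with hx
  have hx0 : 0 < x := by rw [hx]; linarith
  have hx1 : x < 1 := by rw [hx]; linarith
  have hx34 : 3 / 4 ≤ x := by rw [hx]; linarith
  -- `-log(1-x) = log(16 T ℓ) ≤ 4ℓ`
  have hL : -Real.log (1 - x) = Real.log 16 + ℓ + Real.log ℓ := by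
    rw [hx, sub_sub_cancel, hε, one_div, Real.log_inv, neg_neg,
      Real.log_mul (by positivity) (by positivity), Real.log_mul (by norm_num) (by positivity)]
  have hLle : -Real.log (1 - x) ≤ 4 * ℓ := by
    rw [hL]
    have h1 := log_sixteen_le
    have h2 : Real.log ℓ ≤ ℓ - 1 := Real.log_le_sub_one_of_pos (by linarith)
    linarith
  have hLpos : 0 < -Real.log (1 - x) := by
    have : Real.log (1 - x) < 0 := Real.log_neg (by linarith) (by linarith); linarith
  -- the generating-function bound
  have hgf := sum_f_le_gf T hx0 hx1
  rw [tsum_f_tail]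
  have hTε : (T : ℝ) * (1 - x) = 1 / (16 * ℓ) := by
    rw [hx, sub_sub_cancel, hε]
    field_simp
  rw [hTε] at hgf
  -- `x / (-log(1-x)) ≥ (3/4)/(4ℓ) = 3/(16 ℓ)`
  have hmain : 3 / (16 * ℓ) ≤ x / (-Real.log (1 - x)) := by
    rw [div_le_div_iff₀ (by positivity) hLpos]
    nlinarith
  have : 1 / (8 * ℓ) = 3 / (16 * ℓ) - 1 / (16 * ℓ) := by field_simp; norm_num
  linarith

/-- **Infinite mean**: `Σ k f_k = ∞` (else `1 - F(x) ≤ m (1-x)`, contradicting `1 - F(x) = x/(-log(1-x))`).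
[cite: Feller1968, Ch. XIII §3 (the mean recurrence time μ = F'(1); u_n → 1/μ); Kaluza1928, Satz 3] -/
theorem not_summable_mul_f : ¬ Summable fun k : ℕ => (k : ℝ) * f k := by
  intro hsum
  set m := ∑' k : ℕ, (k : ℝ) * f k with hm
  have hm0 : 0 ≤ m := tsum_nonneg fun k : ℕ => mul_nonneg (Nat.cast_nonneg k) (f_nonneg k)
  -- for every `x ∈ (0,1)`: `x / (-log (1-x)) ≤ m (1 - x)`
  have key : ∀ x : ℝ, 0 < x → x < 1 → x / (-Real.log (1 - x)) ≤ m * (1 - x) := by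
    intro x h0 h1
    have hF := tsum_f_mul_pow_eq h0 h1
    have hsfx := summable_f_mul_pow h0.le h1
    -- `1 - F(x) = Σ f_k (1 - x^k) ≤ Σ f_k k (1-x)`
    have h1F : x / (-Real.log (1 - x)) = ∑' k, f k * (1 - x ^ k) := by
      have e : ∑' k, f k * (1 - x ^ k) = (∑' k, f k) - ∑' k, f k * x ^ k := by
        rw [← summable_f.tsum_sub hsfx]; exact tsum_congr fun k => by ring
      rw [e, hasSum_f.tsum_eq, hF]; ring
    rw [h1F]
    have hle : ∀ k : ℕ, f k * (1 - x ^ k) ≤ (1 - x) * ((k : ℝ) * f k) := fun k => by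
      have := mul_le_mul_of_nonneg_left (one_sub_pow_le h0.le k) (f_nonneg k)
      nlinarith [f_nonneg k]
    have hsm : Summable fun k : ℕ => f k * (1 - x ^ k) :=
      Summable.of_nonneg_of_le (fun k => mul_nonneg (f_nonneg k) (sub_nonneg.2 (pow_le_one₀ h0.le h1.le)))
        (fun k => mul_le_of_le_one_right (f_nonneg k) (sub_le_self _ (pow_nonneg h0.le k))) summable_f
    calc ∑' k, f k * (1 - x ^ k) ≤ ∑' k : ℕ, (1 - x) * ((k : ℝ) * f k) :=
          hsm.tsum_le_tsum hle (hsum.mul_left (1 - x))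
      _ = m * (1 - x) := by rw [tsum_mul_left, hm, mul_comm]
  -- take `1 - x = exp(-K)` with `K = 4m + 4`
  set K : ℝ := 4 * m + 4 with hK
  have hK0 : 0 ≤ K := by rw [hK]; linarith
  set x : ℝ := 1 - Real.exp (-K) with hx
  have hexlt : Real.exp (-K) < 1 := Real.exp_lt_one_iff.2 (by linarith)
  have hx0 : 0 < x := by rw [hx]; linarith
  have hx1 : x < 1 := by rw [hx]; linarith [Real.exp_pos (-K)]
  have h := key x hx0 hx1
  have hlog : -Real.log (1 - x) = K := by rw [hx, sub_sub_cancel, Real.log_exp]; ring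
  rw [hlog, show 1 - x = Real.exp (-K) by rw [hx]; ring] at h
  -- `exp K ≥ K²/2`, so `m exp(-K) K ≤ 2m/K < 1/2 ≤ x`... contradiction
  have hexpK : K ^ 2 / 2 ≤ Real.exp K := by
    have := Real.quadratic_le_exp_of_nonneg hK0; nlinarith
  have hKpos : 0 < K := by rw [hK]; linarith
  have hx12 : 1 / 2 ≤ x := by
    rw [hx]
    have : Real.exp (-K) ≤ 1 / 2 := by
      rw [Real.exp_neg, inv_le_comm₀ (Real.exp_pos K) (by norm_num)]
      have h4 : (4 : ℝ) ≤ K := by rw [hK]; linarith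
      nlinarith
    linarith
  -- from `h`: `x ≤ K * (m * exp(-K))`
  rw [div_le_iff₀ hKpos] at h
  have hmexp : m * Real.exp (-K) * K ≤ 2 * m / K := by
    rw [Real.exp_neg, le_div_iff₀ hKpos]
    have hinv : (Real.exp K)⁻¹ ≤ 2 / K ^ 2 := by
      rw [inv_le_comm₀ (Real.exp_pos K) (by positivity)]
      rw [inv_div]; linarith
    calc m * (Real.exp K)⁻¹ * K * K = m * K ^ 2 * (Real.exp K)⁻¹ := by ring
      _ ≤ m * K ^ 2 * (2 / K ^ 2) := mul_le_mul_of_nonneg_left hinv (by positivity)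
      _ = 2 * m := by field_simp
  have h2mK : 2 * m / K < 1 / 2 := by
    rw [div_lt_iff₀ hKpos, hK]; linarith
  linarith

/-! ### The abstract axiom class and the witness -/

/-- The abstract renewal–unfolding system: the properties of `(μ, b_n, λ_n, c_n)` that the lane's `1/log`-rate proofs
(R16 tail, R25a Kesten tail `ε_T ≤ 2/log(T/μ)`, R25c `E_n[#break points] ≥ log n/10 − K`, `λ_n/b_n ≤ K/log n`) use
and nothing else: Hammersley–Welsh in generating-function form, super/sub-multiplicativity, the renewal equation,
Kesten's relation, and (DCH 2.5) infinite mean. (Planner's statement, a-idea-1 `Sketch_G9.lean` §R44, verbatim.)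
[cite: MadrasSlade1993, §1.2 (1.2.10)/(1.2.17), Corollary 3.1.8, §4.2 (Kesten's relation); DuminilCopinHammond2013, Theorem 2.5] -/
structure _root_.Literature.Probability.RandomPlanarGeometry.SAW.RenewalHWSystem where
  μ : ℝ
  b : ℕ → ℝ
  lam : ℕ → ℝ
  c : ℕ → ℝ
  one_lt_μ : 1 < μ
  b_pos : ∀ n, 0 < b n
  lam_nonneg : ∀ n, 0 ≤ lam n
  b_zero : b 0 = 1
  lam_zero : lam 0 = 0
  renewal : ∀ n, 1 ≤ n → b n = ∑ k ∈ Finset.Icc 1 n, lam k * b (n - k)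
  kesten : HasSum (fun k => lam k / μ ^ k) 1
  b_supermul : ∀ m n, b m * b n ≤ b (m + n)
  b_le_pow : ∀ n, b n ≤ μ ^ n
  pow_le_c : ∀ n, μ ^ n ≤ c n
  c_submul : ∀ m n, c (m + n) ≤ c m * c n
  hammersleyWelshGF : ∀ x : ℝ, 0 < x → x * μ < 1 →
    Summable (fun n => c n * x ^ n) ∧
      ∑' n, c n * x ^ n ≤ x⁻¹ * Real.exp (2 * ∑' n, b (n + 1) * x ^ (n + 1))
  infinite_mean : ¬ Summable (fun k : ℕ => (k : ℝ) * lam k / μ ^ k)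

/-- The Kesten tail of an abstract system. (Planner's statement, verbatim.) [cite: MadrasSlade1993, §4.2 (Kesten's relation)] -/
def _root_.Literature.Probability.RandomPlanarGeometry.SAW.RenewalHWSystem.tail (S : RenewalHWSystem) (T : ℕ) : ℝ :=
  ∑' k, S.lam (k + T + 1) / S.μ ^ (k + T + 1)

/-- **R44 (barrier statement)**: there is an abstract renewal–unfolding system whose Kesten tail is `≥ 1/(8 log T)`
for all `T ≥ 3` — so no proof that uses only the listed axioms can improve the lane's `ε_T ≤ 2/log(T/μ)` beyond the
constant. (Planner's statement, verbatim.) [cite: Kaluza1928, Satz 3 (the witness u_n = 1/(n+1))] -/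
def _root_.Literature.Probability.RandomPlanarGeometry.SAW.LogCeilingWitness : Prop :=
  ∃ S : RenewalHWSystem, ∀ T : ℕ, 3 ≤ T → 1 / (8 * Real.log T) ≤ S.tail T

/-- `Σ_{k ∈ Icc 1 n} g k = Σ_{j < n} g (j+1)`. [cite: Feller1968, Ch. XIII §3] -/
private theorem sum_Icc_one_eq_sum_range (g : ℕ → ℝ) : ∀ n, ∑ k ∈ Icc 1 n, g k = ∑ j ∈ range n, g (j + 1)
  | 0 => by simp
  | n + 1 => by rw [Finset.sum_Icc_succ_top (by omega), sum_Icc_one_eq_sum_range g n, Finset.sum_range_succ]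

/-- `u_m u_n ≤ u_{m+n}` (super-multiplicativity of the witness). [cite: MadrasSlade1993, §1.2, eq. (1.2.17) (b is super-multiplicative)] -/
theorem u_mul_le (m n : ℕ) : u m * u n ≤ u (m + n) := by
  unfold u
  rw [div_mul_div_comm, one_mul, div_le_div_iff₀ (by positivity) (by positivity)]
  push_cast
  nlinarith [(Nat.cast_nonneg m : (0 : ℝ) ≤ m), (Nat.cast_nonneg n : (0 : ℝ) ≤ n)]

/-- **The Hammersley–Welsh generating-function axiom for the witness** (`μ = 2`, `c_n = 2^n`, `b_n = 2^n/(n+1)`): for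
`0 < x < 1/2`, `Σ (2x)^n = 1/(1-2x) ≤ x⁻¹ exp(2 Σ_{n≥1} (2x)^n/(n+1))`, because `Σ_{n≥1} y^n/(n+1) ≥ -(1/2) log(1-y)`.
[cite: MadrasSlade1993, Corollary 3.1.8, eq. (3.1.15) (the HW inequality in generating-function form)] -/
theorem hwGF_witness {x : ℝ} (h0 : 0 < x) (h1 : x * 2 < 1) :
    Summable (fun n => (2 : ℝ) ^ n * x ^ n) ∧
      ∑' n, (2 : ℝ) ^ n * x ^ n ≤ x⁻¹ * Real.exp (2 * ∑' n, (2 : ℝ) ^ (n + 1) * u (n + 1) * x ^ (n + 1)) := by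
  set y := 2 * x with hy
  have hy0 : 0 < y := by rw [hy]; linarith
  have hy1 : y < 1 := by rw [hy]; linarith
  have hgeom : Summable fun n => y ^ n := summable_geometric_of_lt_one hy0.le hy1
  have hfun : (fun n => (2 : ℝ) ^ n * x ^ n) = fun n => y ^ n := by funext n; rw [hy, mul_pow]
  refine ⟨by rw [hfun]; exact hgeom, ?_⟩
  rw [hfun, tsum_geometric_of_lt_one hy0.le hy1]
  -- the exponent: `Σ y^{n+1}/(n+2) ≥ (1/2) Σ y^{n+1}/(n+1) = -(1/2) log(1-y)`
  have hlog := Real.hasSum_pow_div_log_of_abs_lt_one (show |y| < 1 by rw [abs_of_pos hy0]; exact hy1)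
  have hterm : ∀ n : ℕ, (1 / 2) * (y ^ (n + 1) / (n + 1)) ≤ (2 : ℝ) ^ (n + 1) * u (n + 1) * x ^ (n + 1) := by
    intro n
    rw [show (2 : ℝ) ^ (n + 1) * u (n + 1) * x ^ (n + 1) = y ^ (n + 1) * u (n + 1) by rw [hy, mul_pow]; ring]
    unfold u
    have hy' : 0 ≤ y ^ (n + 1) := pow_nonneg hy0.le _
    rw [div_eq_mul_one_div (y ^ (n + 1)), ← mul_assoc, mul_comm (1 / 2 : ℝ), mul_assoc]
    apply mul_le_mul_of_nonneg_left _ hy'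
    rw [div_mul_div_comm, one_mul, div_le_div_iff₀ (by positivity) (by positivity)]
    push_cast; linarith
  have hsum2 : Summable fun n : ℕ => (2 : ℝ) ^ (n + 1) * u (n + 1) * x ^ (n + 1) := by
    refine Summable.of_nonneg_of_le (fun n => ?_) (fun n => ?_) ((summable_geometric_of_lt_one hy0.le hy1).mul_left y)
    · exact mul_nonneg (mul_nonneg (pow_nonneg (by norm_num) _) (u_pos _).le) (pow_nonneg h0.le _)
    · rw [show (2 : ℝ) ^ (n + 1) * u (n + 1) * x ^ (n + 1) = y ^ (n + 1) * u (n + 1) by rw [hy, mul_pow]; ring,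
        pow_succ', mul_assoc]
      exact mul_le_mul_of_nonneg_left (mul_le_of_le_one_right (pow_nonneg hy0.le _) (u_le_one _)) hy0.le
  have hexp_ge : (1 / 2) * (-Real.log (1 - y)) ≤ ∑' n, (2 : ℝ) ^ (n + 1) * u (n + 1) * x ^ (n + 1) :=
    hasSum_le hterm (hlog.mul_left (1 / 2)) hsum2.hasSum
  have h1y : 0 < 1 - y := by linarith
  have hexp : (1 - y)⁻¹ ≤ Real.exp (2 * ∑' n, (2 : ℝ) ^ (n + 1) * u (n + 1) * x ^ (n + 1)) := by
    calc (1 - y)⁻¹ = Real.exp (-Real.log (1 - y)) := by rw [Real.exp_neg, Real.exp_log h1y]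
      _ ≤ _ := Real.exp_le_exp.2 (by linarith)
  have hxinv : 1 ≤ x⁻¹ := by rw [one_le_inv₀ h0]; linarith
  calc (1 - y)⁻¹ = 1 * (1 - y)⁻¹ := (one_mul _).symm
    _ ≤ x⁻¹ * Real.exp (2 * ∑' n, (2 : ℝ) ^ (n + 1) * u (n + 1) * x ^ (n + 1)) :=
        mul_le_mul hxinv hexp (inv_pos.2 h1y).le (by linarith)

/-- **The Kaluza witness** `μ = 2`, `b_n = 2^n/(n+1)`, `λ_n = 2^n f_n` (Gregory coefficients), `c_n = 2^n`.
[cite: Kaluza1928, Satz 3] -/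
def witness : RenewalHWSystem where
  μ := 2
  b n := 2 ^ n * u n
  lam n := 2 ^ n * f n
  c n := 2 ^ n
  one_lt_μ := by norm_num
  b_pos n := mul_pos (pow_pos (by norm_num) n) (u_pos n)
  lam_nonneg n := mul_nonneg (pow_nonneg (by norm_num) n) (f_nonneg n)
  b_zero := by simp [u_zero]
  lam_zero := by simp [f_zero]
  renewal n hn := by
    rw [sum_Icc_one_eq_sum_range, renewal hn, Finset.mul_sum]
    refine Finset.sum_congr rfl fun j hj => ?_
    have hj' := Finset.mem_range.1 hj
    have e2 : (2 : ℝ) ^ n = 2 ^ (j + 1) * 2 ^ (n - 1 - j) := by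
      rw [← pow_add, show j + 1 + (n - 1 - j) = n by omega]
    rw [show n - (j + 1) = n - 1 - j by omega, e2]
    ring
  kesten := by
    have : (fun k => (2 : ℝ) ^ k * f k / 2 ^ k) = f := by
      funext k; field_simp
    rw [this]; exact hasSum_f
  b_supermul m n := by
    rw [show (2 : ℝ) ^ m * u m * (2 ^ n * u n) = 2 ^ (m + n) * (u m * u n) by rw [pow_add]; ring]
    exact mul_le_mul_of_nonneg_left (u_mul_le m n) (pow_nonneg (by norm_num) _)
  b_le_pow n := mul_le_of_le_one_right (pow_nonneg (by norm_num) n) (u_le_one n)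
  pow_le_c n := le_rfl
  c_submul m n := by rw [pow_add]
  hammersleyWelshGF x h0 h1 := by
    exact hwGF_witness h0 h1
  infinite_mean := by
    have : (fun k : ℕ => (k : ℝ) * (2 ^ k * f k) / 2 ^ k) = fun k : ℕ => (k : ℝ) * f k := by
      funext k; field_simp
    rw [this]; exact not_summable_mul_f

/-- The tail of the witness is the tail of `f`. [cite: Kaluza1928, Satz 3] -/
theorem witness_tail (T : ℕ) : witness.tail T = ∑' k, f (k + T + 1) := by
  unfold RenewalHWSystem.tail
  refine tsum_congr fun k => ?_
  show (2 : ℝ) ^ (k + T + 1) * f (k + T + 1) / 2 ^ (k + T + 1) = f (k + T + 1)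
  field_simp

/-- **R44 «LOG-CEILING» — the renewal/unfolding axiom class cannot beat `1/log`** (lane «pcv-sawmu», a-idea-1 G9, stub
`stub_R44_1_logCeiling`): the Kaluza witness satisfies every axiom of `RenewalHWSystem` and has Kesten tail
`≥ 1/(8 log T)` for all `T ≥ 3`. [cite: Kaluza1928, Satz 3 (witness); MadrasSlade1993, §4.2 (axioms)] -/
theorem _root_.Literature.Probability.RandomPlanarGeometry.SAW.logCeilingWitness : LogCeilingWitness :=
  ⟨witness, fun T hT => by rw [witness_tail]; exact tail_ge T hT⟩

end LogCeiling

/-- **R44 «LOG-CEILING»** `LogCeilingWitness`, discharged under the exact `<Fact>_holds` name that the tree's named-fact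
accounting keys on (the same proof as `logCeilingWitness`). [cite: Kaluza1928, Satz 3 (witness); MadrasSlade1993, §4.2 (axioms)] -/
theorem LogCeilingWitness_holds : LogCeilingWitness := logCeilingWitness

end Literature.Probability.RandomPlanarGeometry.SAW

end
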